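import Summits.QuantumFields.BalabanUV.Beta.AxialDressingRootedBmLinear

/-!
# `BalabanUV.Beta.GAN24.SrecChargeBm` — binder row G-an2-4 / (CONV-C), S-slot on the literal of record (family (E)): THE BLOCK-MEAN AXIAL DRESSING
# PRESERVES CHARGES — `Π_bm` does not change the lattice total of any component of a summable 1-form, hence the DRESSED minimiser columns
# `colH (coDressKBmAt ρ N K) N μ y` have the totals of the undressed ones (row SR-L3 (Z-b) «charge law of the dressed push», core identity, of
# `HOME/b2b-balaban-gan24-p1/SKELETON-SREC.md` v0.1; unit `b2b-balaban-gan24-p1`, gen 12)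

NOT IN PRINT; OUR BOOKKEEPING.  HONEST FRAMING (cell contract, verbatim): «discharging `BetaPertH` makes Bałaban's UV stability UNCONDITIONAL —
a real constructive-QFT result; it is NOT the continuum limit and NOT the Clay problem.»  HONEST DEPENDENCY (verbatim): «continuum YM on T⁴ ⇐
BetaPertH ∧ nine spine estimates (0/9 proved); BetaPertH ⇐ (D1) ∧ (D4) ∧ CAP+tail; G-an2-4 gates asym, D1 and NE2/3/4.»  [folklore] lattice-sum
bookkeeping over an2's block-mean dressing objects BY NAME (`AxialProjectorBlockMean.axProjBmAt`/`contourSum_axProjBmAt`, `AxialDressingRooted.pmBm`/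
`bondInd`/`cube`/`window_of_pmBm_ne_zero`/`coProjBmAt`/`coProjBmW`/`sum_tsum_mul_coProjBmAt`/`colH_coDressKBmAt_eq`), the lead's `AffineAveraging.contourSum`
and `KKTFluctuationEnergy.tsum_blocks`/`tsum_shift`; generic dimension; NO estimate, NO cited fact, NO `def`, NO `def … : Prop`, NO wall binder; reserved
families untouched.  Discharges NOTHING of (hS, hSall) on (E); NOT BetaPertH, NOT continuum, NOT Clay.

## The finding (kernel-checked below; `ρ = toSite r`, `r ∈ box`, `1 ≤ N`)
* `tsum_contourSum`: `Σ'_y contourSum N F κ y = N · Σ'_x F κ x` for a summable component (`tsum_blocks` + `tsum_shift`): the straight block-contour sums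
  count every bond `N` times in total.
* `tsum_pmBm_col`: **the column sums of the matrix of `Π_bm` are Kronecker**: `Σ'_p pmBm ρ N β p α q = [β = α]` — `Π_bm δ_{(α,q)}` differs from `δ_{(α,q)}` by
  the gradient of a block-local function, whose lattice total vanishes; proved through `contourSum_axProjBmAt` (`𝒬 ∘ Π_bm = 𝒬`) and `tsum_contourSum`.
* `coProjBmAt_const`: `Πᵀ_bm` FIXES every translation-invariant test 1-form, `coProjBmAt ρ N (fun β _ ↦ c β) α q = c α` (window sum = lattice sum by
  `window_of_pmBm_ne_zero`).
* **`tsum_coProjBmW`**: for summable weights `A`, `Σ'_u coProjBmW ρ N A κ u = Σ'_u A κ u` — THE DRESSED WEIGHT FAMILY HAS THE UNDRESSED TOTALS, component by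
  component (an2's windowed adjunction `sum_tsum_mul_coProjBmAt` against the indicator of the component).
* **`tsum_colH_coDressKBmAt`**: for a decaying `K`, `Σ'_u colH (coDressKBmAt ρ N K) N μ y κ u = Σ'_u colH K N μ y κ u` — the `ℋ`-columns of the CO-DRESSED
  resolvent (the legs of (E)'s one-step push, `WardLocusRecursive.SrecAt_succ`; `colH_coDressKBmAt_eq`) carry the SAME zero-momentum masses as the undressed
  ones: every charge ∕ coset-mass bookkeeping of roads S3 ∕ W3 (`sum_wilsonA_eq_zero`, `RespStepSemigroup.respStep_self`, `HessianTelescopingKKT.constReproSum_stepCol`)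
  transfers to the dressed legs unchanged — the (Z-b) input of SR-L3; the gradient ∕ higher moments are NOT claimed preserved (they are not).
-/

noncomputable section

open Finset
open scoped BigOperators
open Literature.MathematicalPhysics.QuantumFieldTheory
open Literature.MathematicalPhysics.QuantumFieldTheory.Balaban1983to89
open Literature.MathematicalPhysics.QuantumFieldTheory.Balaban1983to89.Beta
open ExpKernelCalculus (MKer Decays)
open AffineAveraging (Form0 Form1 box toSite unitVec contourSum)
open OneStepResolventKernel (Fib)
open OneStepKernelFamily (colH)
open KKTFluctuationEnergy (tsum_blocks summable_blocks tsum_shift summable_shift)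
open Summit.QuantumFields.BalabanUV.Beta.AxialProjectorBlockMean (axProjBmAt contourSum_axProjBmAt)
open Summit.QuantumFields.BalabanUV.Beta.AxialDressingRooted (pmBm bondInd bondInd_apply cube mem_cube zero_mem_cube window_of_pmBm_ne_zero
  coProjBmAt coProjBmAt_apply coProjBmW coProjBmW_apply sum_tsum_mul_coProjBmAt coDressKBmAt colH_coDressKBmAt_eq)

namespace Summit.QuantumFields.BalabanUV.Beta.GAN24.SrecChargeBm

variable {d : ℕ}

/-! ## §1 The straight block-contour sums count every bond `N` times -/

/-- [folklore] **TOTAL OF THE CONTOUR SUMS**: for a summable component `F κ`, `Σ'_y contourSum N F κ y = N · Σ'_x F κ x`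
(the `(y, b)`-reindexing `KKTFluctuationEnergy.tsum_blocks` per contour step `s`, then shift invariance `tsum_shift`). -/
theorem tsum_contourSum (N : ℕ) [NeZero N] {F : Form1 (d + 1) ℝ} {κ : Fin (d + 1)} (hF : Summable (F κ)) :
    ∑' y, contourSum N F κ y = (N : ℝ) * ∑' x, F κ x := by
  -- per contour step `s`, the shifted component is summable and its block re-indexing is `tsum_blocks`
  have hs : ∀ s : ℕ, Summable fun x : Fin (d + 1) → ℤ => F κ (x + (s : ℤ) • unitVec κ) := fun s => summable_shift hF _
  have e1 : ∀ y : Fin (d + 1) → ℤ, contourSum N F κ y =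
      ∑ s ∈ Finset.range N, ∑ b ∈ box (d + 1) N, F κ ((N : ℤ) • y + toSite b + (s : ℤ) • unitVec κ) := by
    intro y
    rw [contourSum, Finset.sum_comm]
  simp_rw [e1]
  rw [Summable.tsum_finsetSum (fun s _ => summable_blocks (N := N) (hs s))]
  have e2 : ∀ s ∈ Finset.range N, ∑' y : Fin (d + 1) → ℤ, ∑ b ∈ box (d + 1) N, F κ ((N : ℤ) • y + toSite b + (s : ℤ) • unitVec κ)
      = ∑' x, F κ x := by
    intro s _
    rw [← tsum_blocks (N := N) (hs s)]
    exact tsum_shift (F κ) _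
  rw [Finset.sum_congr rfl e2, Finset.sum_const, Finset.card_range, nsmul_eq_mul]

/-! ## §2 The column sums of the matrix of `Π_bm` -/

section Columns

variable {N : ℕ} {r : Fin (d + 1) → ℕ}

/-- [folklore] The real bond indicator, as a 1-form. -/
theorem bondInd_real_apply (α : Fin (d + 1)) (q : Fin (d + 1) → ℤ) (β : Fin (d + 1)) (p : Fin (d + 1) → ℤ) :
    (fun κ z => (bondInd α q κ z : ℝ)) β p = if β = α ∧ p = q then 1 else 0 := by
  simp only [bondInd_apply]
  split_ifs <;> simp

/-- [folklore] The total of a component of the real bond indicator is Kronecker in the direction. -/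
theorem tsum_bondInd_real (α : Fin (d + 1)) (q : Fin (d + 1) → ℤ) (β : Fin (d + 1)) :
    ∑' p, (fun κ z => (bondInd α q κ z : ℝ)) β p = if β = α then 1 else 0 := by
  by_cases hβ : β = α
  · simp only [bondInd_real_apply, hβ, true_and, if_true]
    exact tsum_ite_eq q 1
  · simp only [bondInd_real_apply, hβ, false_and, if_false, tsum_zero]

/-- [folklore] A component of the real bond indicator is summable (one point). -/
theorem summable_bondInd_real (α : Fin (d + 1)) (q : Fin (d + 1) → ℤ) (β : Fin (d + 1)) :
    Summable ((fun κ z => (bondInd α q κ z : ℝ)) β) := by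
  refine summable_of_ne_finset_zero (s := {q}) fun p hp => ?_
  rw [Finset.mem_singleton] at hp
  simp only [bondInd_apply, hp, and_false, if_false, Int.cast_zero]

/-- [folklore] A column of the matrix of `Π_bm` is summable (it is carried by the window: `window_of_pmBm_ne_zero`). -/
theorem summable_pmBm_col (hN : 1 ≤ N) (hr : r ∈ box (d + 1) N) (β α : Fin (d + 1)) (q : Fin (d + 1) → ℤ) :
    Summable fun p => pmBm (toSite r) N β p α q := by
  refine summable_of_ne_finset_zero (s := (cube (d + 1) N).map (addLeftEmbedding q)) fun p hp => ?_
  by_contra h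
  refine hp ?_
  rw [Finset.mem_map]
  exact ⟨p - q, window_of_pmBm_ne_zero hN hr h, by simp [addLeftEmbedding]⟩

/-- [folklore] The window sum of a column IS its lattice sum (`window_of_pmBm_ne_zero`). -/
theorem sum_cube_pmBm_eq_tsum (hN : 1 ≤ N) (hr : r ∈ box (d + 1) N) (β α : Fin (d + 1)) (q : Fin (d + 1) → ℤ) :
    ∑ v ∈ cube (d + 1) N, pmBm (toSite r) N β (q + v) α q = ∑' p, pmBm (toSite r) N β p α q := by
  symm
  rw [tsum_eq_sum (s := (cube (d + 1) N).map (addLeftEmbedding q)) ?_, Finset.sum_map]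
  · rfl
  · intro p hp
    by_contra h
    refine hp ?_
    rw [Finset.mem_map]
    exact ⟨p - q, window_of_pmBm_ne_zero hN hr h, by simp [addLeftEmbedding]⟩

/-- [folklore] **THE COLUMN SUMS OF `Π_bm` ARE KRONECKER**: `Σ'_p pmBm ρ N β p α q = [β = α]` — `Π_bm` moves a field by the gradient of a block-local function
(block-mean-free rooted tree gauge), whose lattice total vanishes.  Proof: `N · Σ'_p (Π_bm δ)_β p = Σ'_y 𝒬(Π_bm δ)_β y = Σ'_y 𝒬(δ)_β y = N · Σ'_p δ_β p`
(`tsum_contourSum`, an2's `contourSum_axProjBmAt`). -/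
theorem tsum_pmBm_col [NeZero N] (hr : r ∈ box (d + 1) N) (β α : Fin (d + 1)) (q : Fin (d + 1) → ℤ) :
    ∑' p, pmBm (toSite r) N β p α q = if β = α then 1 else 0 := by
  have hN : 1 ≤ N := Nat.one_le_iff_ne_zero.2 (NeZero.ne N)
  have hNr : (N : ℝ) ≠ 0 := Nat.cast_ne_zero.2 (NeZero.ne N)
  set δ : Form1 (d + 1) ℝ := fun κ z => (bondInd α q κ z : ℝ) with hδ
  have hcol : (fun p => pmBm (toSite r) N β p α q) = axProjBmAt (toSite r) N δ β := by
    funext p; rfl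
  have hsumP : Summable (axProjBmAt (toSite r) N δ β) := hcol ▸ summable_pmBm_col hN hr β α q
  have h1 := tsum_contourSum N (F := axProjBmAt (toSite r) N δ) (κ := β) hsumP
  have h2 := tsum_contourSum N (F := δ) (κ := β) (summable_bondInd_real α q β)
  rw [contourSum_axProjBmAt (toSite r) hN δ] at h1
  rw [hcol, ← tsum_bondInd_real α q β]
  exact mul_left_cancel₀ hNr (h1.symm.trans h2)

/-- [folklore] **`Πᵀ_bm` FIXES TRANSLATION-INVARIANT TEST FORMS**: `coProjBmAt ρ N (fun β _ ↦ c β) α q = c α`. -/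
theorem coProjBmAt_const [NeZero N] (hr : r ∈ box (d + 1) N) (c : Fin (d + 1) → ℝ) (α : Fin (d + 1)) (q : Fin (d + 1) → ℤ) :
    coProjBmAt (toSite r) N (fun β _ => c β) α q = c α := by
  have hN : 1 ≤ N := Nat.one_le_iff_ne_zero.2 (NeZero.ne N)
  rw [coProjBmAt_apply, Finset.sum_comm]
  have e : ∀ β : Fin (d + 1), ∑ v ∈ cube (d + 1) N, pmBm (toSite r) N β (q + v) α q * c β = (if β = α then 1 else 0) * c β := by
    intro β
    rw [← Finset.sum_mul, sum_cube_pmBm_eq_tsum hN hr, tsum_pmBm_col hr]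
  rw [Finset.sum_congr rfl fun β _ => e β]
  simp only [ite_mul, one_mul, zero_mul, Finset.sum_ite_eq', Finset.mem_univ, if_true]

end Columns

/-! ## §3 The dressed weights and the dressed `ℋ`-columns have the undressed totals -/

section Totals

variable {N : ℕ} [NeZero N] {r : Fin (d + 1) → ℕ}

/-- [folklore] **`Π_bm` PRESERVES THE LATTICE TOTAL OF EVERY COMPONENT OF A SUMMABLE WEIGHT FAMILY**:
`Σ'_u coProjBmW ρ N A κ u = Σ'_u A κ u` (an2's windowed adjunction `sum_tsum_mul_coProjBmAt` against the indicator of the component `κ`, which `Πᵀ_bm`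
fixes by `coProjBmAt_const`). -/
theorem tsum_coProjBmW (hr : r ∈ box (d + 1) N) {A : Form1 (d + 1) ℝ} (hA : ∀ κ, Summable (A κ)) (κ₀ : Fin (d + 1)) :
    ∑' u, coProjBmW (toSite r) N A κ₀ u = ∑' u, A κ₀ u := by
  have hN : 1 ≤ N := Nat.one_le_iff_ne_zero.2 (NeZero.ne N)
  have hg : ∀ (κ : Fin (d + 1)) (u : Fin (d + 1) → ℤ), |(fun β (_ : Fin (d + 1) → ℤ) => if β = κ₀ then (1 : ℝ) else 0) κ u| ≤ 1 := by
    intro κ u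
    by_cases h : κ = κ₀ <;> simp [h]
  have h := sum_tsum_mul_coProjBmAt hN hr hA hg
  have eL : ∀ κ : Fin (d + 1), (∑' u, A κ u * coProjBmAt (toSite r) N (fun β _ => if β = κ₀ then (1 : ℝ) else 0) κ u)
      = if κ = κ₀ then ∑' u, A κ u else 0 := by
    intro κ
    simp only [coProjBmAt_const hr (fun β => if β = κ₀ then (1 : ℝ) else 0)]
    by_cases hκ : κ = κ₀
    · simp only [hκ, if_true, mul_one]
    · simp only [hκ, if_false, mul_zero, tsum_zero]
  have eR : ∀ κ' : Fin (d + 1), (∑' u', coProjBmW (toSite r) N A κ' u' * (fun β (_ : Fin (d + 1) → ℤ) => if β = κ₀ then (1 : ℝ) else 0) κ' u')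
      = if κ' = κ₀ then ∑' u', coProjBmW (toSite r) N A κ' u' else 0 := by
    intro κ'
    by_cases hκ : κ' = κ₀
    · simp only [hκ, if_true, mul_one]
    · simp only [hκ, if_false, mul_zero, tsum_zero]
  rw [Finset.sum_congr rfl fun κ _ => eL κ, Finset.sum_congr rfl fun κ' _ => eR κ'] at h
  simp only [Finset.sum_ite_eq', Finset.mem_univ, if_true] at h
  exact h.symm

/-- [folklore] **THE `ℋ`-COLUMNS OF THE CO-DRESSED RESOLVENT CARRY THE UNDRESSED CHARGES**: for a decaying `K`,
`Σ'_u colH (coDressKBmAt ρ N K) N μ y κ u = Σ'_u colH K N μ y κ u` (`colH_coDressKBmAt_eq` + `tsum_coProjBmW`; columns summable by decay). -/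
theorem tsum_colH_coDressKBmAt (hr : r ∈ box (d + 1) N) {K : MKer (d + 1) (Fib d)} {C δ : ℝ} (hK : Decays K C δ) (hδ : 0 < δ)
    (μ : Fin (d + 1)) (y : Fin (d + 1) → ℤ) (κ : Fin (d + 1)) :
    ∑' u, colH (coDressKBmAt (toSite r) N K) N μ y κ u = ∑' u, colH K N μ y κ u := by
  rw [colH_coDressKBmAt_eq]
  exact tsum_coProjBmW hr (fun κ' => AxialDressing.summable_col_of_decays hK hδ ((N : ℤ) • y) (Sum.inl κ') (Sum.inr μ)) κ

end Totals

end Summit.QuantumFields.BalabanUV.Beta.GAN24.SrecChargeBm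

end
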